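import Summits.NavierStokesRegularity.FluidComputer.PalasekTowerHostFields
import Summits.NavierStokesRegularity.FluidComputer.PalasekTowerRegisterGlobalTail
import Summits.NavierStokesRegularity.FluidComputer.PalasekTowerRegisterPushBudget

/-!
# Host preparation, VII: the force and the pinned, rigid, quiet SCHEDULE of the host

Cell `ns-blowup`, seat `ns-blowup-ecbridge-3` (g0); GROUP C «BRIDGE SUPPORT» of the route
`PalasekTowerBreakdown` (crux `EpisodeBaseG`, item stmt-NavierStokesRegularity-19179, BC3 stub
`host_preparation` = the tree Prop `RungG 0` of `PalasekTowerRegisterGlobalTail.lean`). LABEL: E–C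
typing (KERNEL construction). WHAT THIS IS NOT: not Navier–Stokes evidence — a schedule (datum `0`,
an explicit smooth compactly supported force, the rigid window clock) is written down; the force is
the residual of a PRESCRIBED flow, free before the first readout, faded to zero inside the first
growth window. Nothing is claimed about what the Navier–Stokes flow does after `τ₀`.

* §1 the first readout `τ₁ = 1 + w₀` (`w₀ = 4bβ log N₁ / A₀`, the rigid window of level `1`) and the
  FORCE `f(t) = fade(t) • resid(t)` (`fade = 1` on `[0, 1]`, `= 0` from `τ₁`): smooth on `ℝ × ℝ³`,
  supported in `[0, τ₁] × B̄(0, radius)`, hence of Clay class (5)–(6) (`IsSmoothOnHalfSpace`,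
  `HasRapidSpaceTimeDecay` — the compact-box argument of `PalasekTowerForceBudget`);
* §2 `hostSchedule L L_b`: blow-up time `T = 1 + Σ_k w_k`, readouts `τ_k = 1 + Σ_{j<k} w_j`
  (`Schedule.windowTime`, window equality by construction), `c₁ = 1`, `c₂ = 5/3`, `c₃ = 32`,
  `c₄ = 1/200`, `c₅ = 4bβ`, radius `2L + 4L_b + 2`, datum `0`, the force of §1; the clock and
  `τ_k < T` are the tail estimates of `PalasekTowerRegisterWindow` (`wide_window_geo`,
  `wide_window_clock`); `push_small` on the first window is the ONE quantitative hypothesis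
  `hpush : ‖resid(t, x)‖ ≤ Y₀/200` on `[1, τ₁]` (discharged in `PalasekTowerHostPreparation` by
  taking the cut-off scales large), and is free on later windows (force `= 0`);
* §3 the register clauses: `Rigid` (by construction), `Quiet` (fade), `Pins 8 (6/5)`
  (`Schedule.Rigid.pins_of_push_le_one` of `PalasekTowerRegisterPushBudget`: `c₄ ≤ 1` + confinement).

References: S. Palasek, arXiv:2605.13827 §3.3 [cite: Palasek2026ElementaryModel, §3.3];
C. L. Fefferman, Clay problem description, (5) (6) [cite: FeffermanClay2006, (5) (6)].
-/

noncomputable section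

namespace Summit.NavierStokesRegularity.FluidComputer.PalasekTowerClayBridge.Host

open Real Set Function Filter Topology InnerProductSpace Metric
open scoped RealInnerProductSpace ContDiff Topology ENNReal

open Literature.Analysis.FluidPDE

/-- Local notation for physical space `ℝ³ = EuclideanSpace ℝ (Fin 3)`. -/
local notation "ℝ³" => EuclideanSpace ℝ (Fin 3)

/-! ## §1 The first readout and the force -/

/-- **The first growth window** `w₀ = 4bβ log N₁ / A₀` of the wide base. [folklore] -/
def wfirst : ℝ := TowerRates.wide.window 0

/-- **The first grown readout** `τ₁ = 1 + w₀`. [folklore] -/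
def τfirst : ℝ := Schedule.windowTime TowerRates.wide 1

/-- `0 < w₀`. [folklore] -/
theorem wfirst_pos : 0 < wfirst := TowerRates.wide.window_pos 0

/-- `τ₁ = 1 + w₀`. [folklore] -/
theorem τfirst_eq : τfirst = 1 + wfirst := by
  simp [τfirst, wfirst, Schedule.windowTime]

/-- `windowTime 0 = 1`. [folklore] -/
theorem windowTime_zero : Schedule.windowTime TowerRates.wide 0 = 1 := by
  simp [Schedule.windowTime]

/-- The readout times are monotone in the level. [folklore] -/
theorem windowTime_mono : Monotone (Schedule.windowTime TowerRates.wide) := by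
  refine monotone_nat_of_le_succ fun k => ?_
  rw [Schedule.windowTime_succ]
  have := TowerRates.wide.window_pos k
  linarith

/-- **The force of the host**: the residual faded out inside the first window,
`f(t) = fade_{τ₁, w₀}(t) • resid(t)`. [folklore] -/
def force (L Lb : ℝ) (t : ℝ) (x : ℝ³) : ℝ³ := fade τfirst wfirst t • resid L Lb t x

section Force

variable {L Lb : ℝ}

/-- On `(-∞, 1]` the force IS the residual (`fade = 1`). [folklore] -/
theorem force_eq_resid {t : ℝ} (ht : t ≤ 1) (x : ℝ³) : force L Lb t x = resid L Lb t x := by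
  rw [force, fade_of_le wfirst_pos (by rw [τfirst_eq]; linarith), one_smul]

/-- From `τ₁` on the force vanishes. [folklore] -/
theorem force_eq_zero_of_ge {t : ℝ} (ht : τfirst ≤ t) (x : ℝ³) : force L Lb t x = 0 := by
  rw [force, fade_of_ge wfirst_pos ht, zero_smul]

/-- Outside the carrying ball the force vanishes. [folklore] -/
theorem force_eq_zero_of_far (hL : 0 < L) (hLb : 0 < Lb) {x : ℝ³} (hx : radius L Lb < ‖x‖) (t : ℝ) :
    force L Lb t x = 0 := by
  rw [force, resid_eq_zero_of_far hL hLb hx, smul_zero]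

/-- Before `t = 0` the force vanishes. [folklore] -/
theorem force_eq_zero_of_nonpos {t : ℝ} (ht : t ≤ 0) (x : ℝ³) : force L Lb t x = 0 := by
  rw [force, resid_eq_zero_of_nonpos ht, smul_zero]

/-- `‖f‖ ≤ ‖resid‖` (`0 ≤ fade ≤ 1`). [folklore] -/
theorem norm_force_le (t : ℝ) (x : ℝ³) : ‖force L Lb t x‖ ≤ ‖resid L Lb t x‖ := by
  rw [force, norm_smul, Real.norm_eq_abs]
  exact mul_le_of_le_one_left (norm_nonneg _) (abs_fade_le_one t)

/-- **The force is smooth on `ℝ × ℝ³`.** [folklore] -/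
theorem contDiff_uncurry_force : ContDiff ℝ ∞ (uncurry (force L Lb)) :=
  ((contDiff_fade _ _).comp contDiff_fst).smul contDiff_uncurry_resid

/-- **Clay (6)**: the force is smooth on the closed half-space. [cite: FeffermanClay2006, (6)] -/
theorem isSmoothOnHalfSpace_force : IsSmoothOnHalfSpace (force L Lb) :=
  contDiff_uncurry_force.contDiffOn

/-- The force is supported in the box `[0, τ₁] × B̄(0, radius)`. [folklore] -/
theorem tsupport_force_subset (hL : 0 < L) (hLb : 0 < Lb) :
    tsupport (uncurry (force L Lb)) ⊆ Icc 0 τfirst ×ˢ Metric.closedBall (0 : ℝ³) (radius L Lb) := by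
  refine closure_minimal (fun z hz => ?_) (isClosed_Icc.prod Metric.isClosed_closedBall)
  rw [mem_support] at hz
  refine mk_mem_prod ⟨?_, ?_⟩ ?_
  · by_contra h
    exact hz (force_eq_zero_of_nonpos (le_of_lt (not_le.mp h)) z.2)
  · by_contra h
    exact hz (force_eq_zero_of_ge (le_of_lt (not_le.mp h)) z.2)
  · rw [Metric.mem_closedBall, dist_zero_right]
    by_contra h
    exact hz (force_eq_zero_of_far hL hLb (lt_of_not_ge h) z.1)

/-- **Clay (5)**: the force has Fefferman's space-time decay — it is smooth and supported in a
compact box of the half-space, where every weighted derivative is bounded (the argument of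
`PalasekTowerForceBudget.clayForce_of_summable_levels`). [cite: FeffermanClay2006, (5)] -/
theorem hasRapidSpaceTimeDecay_force (hL : 0 < L) (hLb : 0 < Lb) :
    HasRapidSpaceTimeDecay (force L Lb) := by
  intro n K
  set F := uncurry (force L Lb) with hFdef
  have hF : ContDiff ℝ ∞ F := contDiff_uncurry_force
  have hUD : UniqueDiffOn ℝ (Ici (0 : ℝ) ×ˢ (univ : Set ℝ³)) :=
    (uniqueDiffOn_Ici 0).prod uniqueDiffOn_univ
  have hwithin : ∀ z ∈ Ici (0 : ℝ) ×ˢ (univ : Set ℝ³),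
      iteratedFDerivWithin ℝ n F (Ici (0 : ℝ) ×ˢ univ) z = iteratedFDeriv ℝ n F z := fun z hz =>
    iteratedFDerivWithin_eq_iteratedFDeriv hUD (hF.contDiffAt.of_le (by exact_mod_cast le_top)) hz
  set Φ : ℝ × ℝ³ → ℝ := fun z => (1 + ‖z.2‖ + z.1) ^ K * ‖iteratedFDeriv ℝ n F z‖ with hΦdef
  have hΦc : Continuous Φ := by
    have h1 : Continuous fun z : ℝ × ℝ³ => (1 + ‖z.2‖ + z.1) ^ K :=
      ((continuous_const.add continuous_snd.norm).add continuous_fst).pow K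
    exact h1.mul (hF.continuous_iteratedFDeriv (m := n) (by exact_mod_cast le_top)).norm
  have hbox : IsCompact (Icc (0 : ℝ) τfirst ×ˢ Metric.closedBall (0 : ℝ³) (radius L Lb)) :=
    isCompact_Icc.prod (isCompact_closedBall _ _)
  obtain ⟨C, hC⟩ := hbox.exists_bound_of_continuousOn hΦc.continuousOn
  refine ⟨max C 0, fun t ht x => ?_⟩
  have hz : ((t, x) : ℝ × ℝ³) ∈ Ici (0 : ℝ) ×ˢ (univ : Set ℝ³) := mk_mem_prod ht (mem_univ _)
  rw [hwithin _ hz]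
  by_cases hmem : ((t, x) : ℝ × ℝ³) ∈ Icc (0 : ℝ) τfirst ×ˢ Metric.closedBall (0 : ℝ³) (radius L Lb)
  · have := hC _ hmem
    simp only [hΦdef, Real.norm_eq_abs] at this
    exact le_trans (le_trans (le_abs_self _) this) (le_max_left _ _)
  · have hnot : ((t, x) : ℝ × ℝ³) ∉ tsupport F := fun hts => hmem (tsupport_force_subset hL hLb hts)
    have hzero : iteratedFDeriv ℝ n F (t, x) = 0 :=
      Function.notMem_support.mp fun h => hnot (support_iteratedFDeriv_subset n h)
    rw [hzero, norm_zero, mul_zero]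
    exact le_max_right _ _

end Force

/-! ## §2 The schedule -/

/-- **THE SCHEDULE OF THE HOST** on the wide-base rates: the window clock of
`PalasekTowerRegisterWindow` (`τ₀ = 1`, window equality, `c₃ = 32`), the registered constants
`c₁ = 1`, `c₂ = 5/3`, `c₅ = 4bβ`, push constant `c₄ = 1/200`, radius `2L + 4L_b + 2`, ZERO datum
and the faded residual as FORCE. The one quantitative input is `hpush`: on the first growth window
`[1, τ₁]` the residual is at most `Y₀ / 200` (later windows carry no force).
[cite: Palasek2026ElementaryModel, §3.3] -/
def hostSchedule (L Lb : ℝ) (hL : 1 ≤ L) (hLb : 1 ≤ Lb)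
    (hpush : ∀ t ∈ Icc (1 : ℝ) τfirst, ∀ x : ℝ³, ‖resid L Lb t x‖ ≤ 1 / 200 * TowerRates.wide.Y 0) :
    Schedule TowerRates.wide where
  T := 1 + ∑' k, TowerRates.wide.window k
  τ := Schedule.windowTime TowerRates.wide
  τ_zero_pos := by rw [windowTime_zero]; exact one_pos
  τ_lt_succ := fun k => by
    rw [Schedule.windowTime_succ]
    have := TowerRates.wide.window_pos k
    linarith
  τ_lt_T := by
    intro k
    have hgeo := TowerRates.wide_window_geo
    have hs := (Schedule.window_tail_le (R := TowerRates.wide) (r := 1 / 3) (by norm_num) (by norm_num)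
      hgeo 0).1
    simp only [add_zero] at hs
    have hsplit := hs.sum_add_tsum_nat_add k
    have htail := (Schedule.window_tail_le (R := TowerRates.wide) (r := 1 / 3) (by norm_num)
      (by norm_num) hgeo k).1
    have hpos : 0 < ∑' i, TowerRates.wide.window (i + k) := by
      have h1 : TowerRates.wide.window (0 + k) ≤ ∑' i, TowerRates.wide.window (i + k) :=
        htail.le_tsum 0 (fun j _ => (TowerRates.wide.window_pos (j + k)).le)
      have h2 := TowerRates.wide.window_pos (0 + k)
      linarith
    show Schedule.windowTime TowerRates.wide k < 1 + ∑' k, TowerRates.wide.window k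
    unfold Schedule.windowTime
    linarith
  c₁ := 1
  c₂ := 5 / 3
  c₃ := 32
  c₄ := 1 / 200
  c₅ := 4 * TowerRates.wide.b * TowerRates.wide.β
  c₁_pos := one_pos
  c₄_le := by norm_num
  c₅_le := le_rfl
  gap := by
    have h := TowerRates.wide_sep 0
    have hY0 := wide_Y_zero_pos
    linarith
  radius := radius L Lb
  clock := by
    intro k
    have hgeo := TowerRates.wide_window_geo
    have hclock := TowerRates.wide_window_clock
    have hs := (Schedule.window_tail_le (R := TowerRates.wide) (r := 1 / 3) (by norm_num) (by norm_num)
      hgeo 0).1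
    simp only [add_zero] at hs
    have hsplit := hs.sum_add_tsum_nat_add (k + 1)
    obtain ⟨_, htail⟩ := Schedule.window_tail_le (R := TowerRates.wide) (r := 1 / 3) (by norm_num)
      (by norm_num) hgeo (k + 1)
    have hA : 0 < TowerRates.wide.A k := TowerRates.wide.A_pos k
    have hwk : TowerRates.wide.window (k + 1) / (1 - 1 / 3) ≤ 32 / TowerRates.wide.A k := by
      rw [div_le_div_iff₀ (by norm_num) hA]
      have := hclock k
      nlinarith
    show (1 + ∑' k, TowerRates.wide.window k) - Schedule.windowTime TowerRates.wide (k + 1) ≤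
      32 / TowerRates.wide.A k
    unfold Schedule.windowTime
    linarith
  u₀ := 0
  datum_decay := by
    intro n K
    refine ⟨0, fun x => ?_⟩
    simp
  f := force L Lb
  force_smooth := isSmoothOnHalfSpace_force
  force_decay := hasRapidSpaceTimeDecay_force (by linarith) (by linarith)
  force_silent := by
    intro t ht x
    have h1 : Schedule.windowTime TowerRates.wide 1 < 1 + ∑' k, TowerRates.wide.window k := by
      have hgeo := TowerRates.wide_window_geo
      have hs := (Schedule.window_tail_le (R := TowerRates.wide) (r := 1 / 3) (by norm_num)
        (by norm_num) hgeo 0).1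
      simp only [add_zero] at hs
      have hsplit := hs.sum_add_tsum_nat_add 1
      have htail := (Schedule.window_tail_le (R := TowerRates.wide) (r := 1 / 3) (by norm_num)
        (by norm_num) hgeo 1).1
      have hpos : 0 < ∑' i, TowerRates.wide.window (i + 1) := by
        have h1 : TowerRates.wide.window (0 + 1) ≤ ∑' i, TowerRates.wide.window (i + 1) :=
          htail.le_tsum 0 (fun j _ => (TowerRates.wide.window_pos (j + 1)).le)
        have h2 := TowerRates.wide.window_pos (0 + 1)
        linarith
      unfold Schedule.windowTime
      linarith
    exact force_eq_zero_of_ge (le_of_lt (lt_of_lt_of_le h1 ht)) x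
  push_small := by
    intro k t ht x
    rcases Nat.eq_zero_or_pos k with hk | hk
    · subst hk
      rw [windowTime_zero] at ht
      have ht' : t ∈ Icc (1 : ℝ) τfirst := ⟨ht.1, ht.2⟩
      exact (norm_force_le t x).trans (hpush t ht' x)
    · have h1 : τfirst ≤ t := le_trans (windowTime_mono hk) ht.1
      rw [force_eq_zero_of_ge h1 x, norm_zero]
      have hY : 0 < TowerRates.wide.Y k := Real.rpow_pos_of_pos (TowerRates.wide.N_pos k) _
      positivity
  loop := fun _ _ => 0
  loop_smooth := fun _ => contDiff_const
  loop_closed := fun _ => rfl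
  Φ := fun _ => 1
  Φ_pos := fun _ => one_pos

/-! ## §3 The register clauses of the schedule -/

section Clauses

variable {L Lb : ℝ} (hL : 1 ≤ L) (hLb : 1 ≤ Lb)
  (hpush : ∀ t ∈ Icc (1 : ℝ) τfirst, ∀ x : ℝ³, ‖resid L Lb t x‖ ≤ 1 / 200 * TowerRates.wide.Y 0)

/-- The force of the schedule. [folklore] -/
theorem hostSchedule_f : (hostSchedule L Lb hL hLb hpush).f = force L Lb := rfl

/-- The readouts of the schedule. [folklore] -/
theorem hostSchedule_τ : (hostSchedule L Lb hL hLb hpush).τ = Schedule.windowTime TowerRates.wide := rfl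

/-- `τ 0 = 1`. [folklore] -/
theorem hostSchedule_τ_zero : (hostSchedule L Lb hL hLb hpush).τ 0 = 1 := windowTime_zero

/-- `τ 1 = τ₁`. [folklore] -/
theorem hostSchedule_τ_one : (hostSchedule L Lb hL hLb hpush).τ 1 = τfirst := rfl

/-- The radius of the schedule. [folklore] -/
theorem hostSchedule_radius : (hostSchedule L Lb hL hLb hpush).radius = radius L Lb := rfl

/-- `c₁ = 1`. [folklore] -/
theorem hostSchedule_c₁ : (hostSchedule L Lb hL hLb hpush).c₁ = 1 := rfl

/-- `c₂ = 5/3`. [folklore] -/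
theorem hostSchedule_c₂ : (hostSchedule L Lb hL hLb hpush).c₂ = 5 / 3 := rfl

/-- The datum is zero. [folklore] -/
theorem hostSchedule_u₀ : (hostSchedule L Lb hL hLb hpush).u₀ = 0 := rfl

/-- **RIGID** (window equality, `c₅ = 4bβ`, `c₁ = 1`, `c₂ = 5/3` — by construction). [folklore] -/
theorem hostSchedule_rigid : (hostSchedule L Lb hL hLb hpush).Rigid where
  window_eq := fun k => by
    show Schedule.windowTime TowerRates.wide (k + 1) = Schedule.windowTime TowerRates.wide k +
      4 * TowerRates.wide.b * TowerRates.wide.β * Real.log (TowerRates.wide.N (k + 1)) /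
        TowerRates.wide.A k
    rw [Schedule.windowTime_succ]
    rfl
  c₅_eq := rfl
  c₁_eq := rfl
  c₂_eq := rfl

/-- **QUIET** (the force vanishes from `τ 1 = τ₁` on). [folklore] -/
theorem hostSchedule_quiet : (hostSchedule L Lb hL hLb hpush).Quiet := by
  intro t ht
  funext x
  exact force_eq_zero_of_ge ht x

/-- **PINNED** with `Λ = 8`, `θ = 6/5` (`c₄ = 1/200 ≤ 1`, datum and force confined to the ball;
`Schedule.Rigid.pins_of_push_le_one`). [folklore] -/
theorem hostSchedule_pins : (hostSchedule L Lb hL hLb hpush).Pins 8 (6 / 5) :=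
  (hostSchedule_rigid hL hLb hpush).pins_of_push_le_one (by show (1 : ℝ) / 200 ≤ 1; norm_num)
    (fun _ _ => rfl)
    (fun t x hx => force_eq_zero_of_far (by linarith) (by linarith) hx t)

end Clauses

end Summit.NavierStokesRegularity.FluidComputer.PalasekTowerClayBridge.Host

end
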